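import Summits.QuantumFields.YangMills.Theorems.BalabanUVNodesN08AlphaEq324RowACReMassedSlotOfRecord
import Summits.QuantumFields.YangMills.Theorems.BalabanUVNodesN08LargeFieldRowZBudget

/-!
# Route «BalabanUVNodes», Track-A DAG node N08 = [Balaban1985UV3] Thm 1 p. 257 ∕ Thm 2 p. 272 — THE RE-MASSED AC TOWER READ FROM THE EDITED (α)-AC CLAUSE, part 5:
# THE HISTORY-EXTENSIVE MASS LETTER — N08's slot of record `Node00.PrintedUV3V N L` from `…RowAC.RunAlphaEq324CoreLTAtAC` (the (3.24) row in print's output-sandwich currency at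
# ANY cumulant letter, range-honest bundle) AND the `dU`-a.e. bound `m_k(h,·) ≤ exp(c_m|T₁^{(k)}| + d(𝔤)c₁·Σ_{j<k}|Z_j(h)|)` (dag-n08-w1 g5's file 24 `…N08SlotOfRecordFromAlphaACMassBoundZAE`,
# p627305, re-entered one (α)-currency lower)

Cell `pub-ymgap`, seat `pub-ymgap-dag-n08-w4` gen 4 (INTENT-5; sequel of parts 1–4 `…RowACReMassed{,Slot,SlotOfRecord,Corollaries}`).  `bears_on: R4∕N08`; `--supports stmt-QuantumFields-27364`
(K1⁹, helper; KEY MAP v2).  THEOREMS ONLY (def-free), sorry-free, standard axioms; dag-n08-w1's files 14∕23∕24∕I-a–III-b and the lane's `Balaban3D/Proofs/*AC` modules consumed BY NAME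
(`lf_towerAC3_of_massBoundZ_const`, `zcoefOf_add_le`, `budget_nonneg`, `step0_reMassed`, `usesConsts_reMassed`, `printedUV3G_of_analyticLeaves_towerAC3_of_window`, …), untouched.

WHAT THIS FILE PROVES (dag-n08-w1's file 24 proofs verbatim with `RunAlphaAC ↦ RunAlphaEq324CoreLTAtAC … c`, the step leaves ∕ B15 ∕ B20 from parts 1–2 and (25) at the chart centre
from p608282's `bound25_vac_coreLTAtAC`):
* §1 ★★ `lf_reMassedZ_of_coreLTAtAC` — B25 POINTWISE at the re-massed tower under the HISTORY-DEPENDENT cap `W′_k(h,U) ≤ exp(c_m|T₁^{(k)}| + d(𝔤)c₁·Σ_{j<k}|Z_j(h)|)`, the Z-rate read with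
  the record's budget (file 23), from the edition's rows (67)∘LF ∕ (68).
* §2 ★★ `nonempty_analyticLeaves_reMassedZ_of_coreLTAtAC` — the whole `UVStability3D.AnalyticLeaves C′ S T′` at the re-massed tower, `C′ = {consts with d := d + c_m}`.
* §3 ★★ `printedUV3G_at_record_of_coreLTAtAC_of_reMassedZ_of_window`; §4 ★★★ `printedUV3V_at_slotOfRecord_of_coreLTAtAC_of_massBoundZAE_of_consts` — **`Node00.PrintedUV3V N L` ⟸ (on the
  family) the EDITED (α)-AC rows at print's averaging ∧ «`massRecAC … k h ≤ exp(c_m|T₁^{(k)}| + d(𝔤)c₁·Σ_{j<k}|Z_j(h)|)` `dU_k`-a.e., `1 ≤ k ≤ K`» ∧ `b₀p₀^{p₀}e^{1−p₀} ≤ εbg`** (the re-massing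
  `min (massRecAC) (e^{c_k + d(𝔤)c₁|Z_{<k}(h)|})` chosen inside the proof) · ★★★ `…_of_consts'` (A6 ∃X form along file 9 §2's inhabitant).
LOCATED READING (R-AC-324⁷; count-neutral, owners decide): N08's residual on the road of record in its weakest typed form to date = the EDITED (α)-AC rows ((3.24) as print's SANDWICH
at the supplier's letter) ∧ ONE `dU_k`-a.e. HISTORY-EXTENSIVE density∕mass bound at print's averaging (dag-n08-w1 (R4⁷)–(R4⁹): bracketed by iterated-Haar-push-forward statements) ∧ the
free numeric window.  HONEST FRAMING: count-neutral helper; hypotheses-only antecedents (= N08's object gap); `PrintedUV3V` NOT proved; N08 NOT discharged; counts unmoved; one finite 𝕋⁴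
programme at fixed ε, Bałaban AS PRINTED — R4 closes the conditional finite-𝕋⁴ rung `BalabanLadder.UV` only; the Yang–Mills mass gap (Clay) is NOT proved by any of this; nothing
continuum ∕ ℝ⁴ ∕ OS.

References: [Balaban1985UV3] T. Bałaban, Commun. Math. Phys. 102 (1985) 255–275 — Thm 1 p. 257, Thm 2 p. 272, (7) p. 257, (41) p. 266, (67)–(68) p. 273, pp. 273–274;
[Balaban1985Averaging] (15) p. 19; [Balaban1982Higgs1] (3.24) p. 616.
-/

noncomputable section

open MeasureTheory

namespace Summit.QuantumFields.YangMills.Theorems.BalabanUVNodesN08AlphaEq324RowACReMassedZSlot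

open scoped Matrix.Norms.L2Operator
open Literature.MathematicalPhysics.QuantumFieldTheory.Balaban1983to89
open Literature.MathematicalPhysics.QuantumFieldTheory.Balaban1983to89.Node00 (SU TFamily₃)
open Literature.MathematicalPhysics.QuantumFieldTheory.Balaban1983to89.B10RunsOfRecord
open Literature.MathematicalPhysics.QuantumFieldTheory.Balaban1985CMP102
open Literature.MathematicalPhysics.QuantumFieldTheory.Balaban1985CMP102.Setting
open Literature.MathematicalPhysics.QuantumFieldTheory.Balaban1985CMP102.Theorems (Family)
open Summit.QuantumFields.Balaban3D
open Summit.QuantumFields.Balaban3D.Carriers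
open Summit.QuantumFields.Balaban3D.Proofs
open Summit.QuantumFields.Balaban3D.Proofs.ScalesArithmetic
open Summit.QuantumFields.Balaban3D.Proofs.Constants (eps0Of consts3_d_eq_log)
open Summit.QuantumFields.Balaban3D.Proofs.FamilyLE (le_of_eps0Of thresholds_of_le)
open Summit.QuantumFields.Balaban3D.Proofs.Family (prov_hb₁ prov_hb₂)
open Summit.QuantumFields.Balaban3D.Proofs.GroupModelLieC (lieC)
open Summit.QuantumFields.Balaban3D.Proofs.TowerAC
open Summit.QuantumFields.Balaban3D.Proofs.SeriesAC
open Summit.QuantumFields.Balaban3D.Proofs.StandardAC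
open Summit.QuantumFields.Balaban3D.Proofs.InputsAC
open Summit.QuantumFields.Balaban3D.Proofs.MassesAC (massRecAC massRecAC_nonneg massRecAC_zero one_le_massRecAC_triv measurable_massRecAC)
open Summit.QuantumFields.Balaban3D.Proofs.AlphaAC (AlphaDataAC StepAlphaAC RunAlphaAC)
open Summit.QuantumFields.Balaban3D.Proofs.Thresholds (gamma71L)
open Summit.QuantumFields.Balaban3D.Proofs.LiftBridge (liftCfg)
open Summit.QuantumFields.Balaban3D.Proofs.Run3SmallFactors (codeZ)
open Summit.QuantumFields.YangMills.BalabanUVNodes.N08Thm2AsPrintedAtSlotOfRecordAC (exists_TFamily₃_of_av_eq exists_externalInputsAC_ofPrint)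
open Summit.QuantumFields.YangMills.BalabanUVNodes.N08Thm2AtRecordFromAlpha (window_of_famConsts pos_of_famConsts consts_adm_of_pos)
open Summit.QuantumFields.YangMills.BalabanUVNodes.N08SlotOfRecordFromAlphaAC (printedUV3G_of_analyticLeaves_towerAC3_of_window)
open Summit.QuantumFields.YangMills.BalabanUVNodes.N08ReMassedACStepBounds (reMassed_mass_eq_zero_of_not_admissible)
open Summit.QuantumFields.YangMills.BalabanUVNodes.N08ReMassedACThm2 (step0_reMassed)
open Summit.QuantumFields.YangMills.Theorems.BalabanUVNodesN08AlphaEq324RowAC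
open Summit.QuantumFields.YangMills.Theorems.BalabanUVNodesN08AlphaEq324RowACEnd (bound25_vac_coreLTAtAC)
open Summit.QuantumFields.YangMills.Theorems.BalabanUVNodesN08AlphaEq324RowACReMassed (logZT_le_reMassed_of_coreLTAtAC)
open Summit.QuantumFields.YangMills.Theorems.BalabanUVNodesN08AlphaEq324RowACReMassedSlot (exists_stepLeaves_reMassed_of_coreLTAtAC bound46_reMassed_of_coreLTAtAC)
open Summit.QuantumFields.YangMills.BalabanUVNodes.N08ReMassedACLeaves (usesConsts_reMassed)
open Summit.QuantumFields.YangMills.BalabanUVNodes.N08LargeFieldRowZBudget (lf_towerAC3_of_massBoundZ_const zcoefOf_add_le budget_nonneg)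
open B7Prop1Explicit (hol plaqWord)
open B7Prop1Local (pdevOn loK plaqHiK)
open B7Prop2Explicit (avgIter)
open B10LargeField (xlog)

/-! ## §1 Row B25 POINTWISE at the re-massed tower under the history-dependent cap -/
section Lane

variable {L : ℕ} {S : Scales L} {G : Type} [GaugeGroup G] [MeasurableSpace G] [HaarData G]
  {𝔊 : GroupModel G} {𝔠 : Primitives.AlphaConsts L 𝔊.N} {X : ExternalInputsAC S G}
  {𝔖 : ∀ k, StepSeries S G ↥(lieC 𝔊) (nblkOf S 𝔠.lane.carrier k) k} {𝔄 : AlphaDataLTAC 𝔊 𝔠 X 𝔖}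
  {c : ∀ k, Hist S.P (k + 1) → GaugeField S.P (k + 1) G → ℕ → ℝ}
  (hfam : S.g ^ 2 * S.ε₀ ≤ (min 𝔠.gamma0 1) ^ 2)
  (W' : HistWeightsAC S.P G) (B' : TowerBaseAC S G) (hB' : B' = { X.toTowerBase 𝔠.lane.carrier with W := W' })
  (hae : ∀ j, j ≤ S.K → ∀ h : Hist S.P j, W'.mass j h =ᵐ[fieldMeasure S.P j G]
    massRecAC 𝔠.lane.carrier.M₁ (rcolOf S 𝔠.lane.carrier) (eps1Of S 𝔠.lane.carrier) (epsSOf S 𝔠.lane.carrier) X.av j h)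
  (hdom : ∀ (j : ℕ) (h : Hist S.P j) (U : GaugeField S.P j G),
    W'.mass j h U ≤ massRecAC 𝔠.lane.carrier.M₁ (rcolOf S 𝔠.lane.carrier) (eps1Of S 𝔠.lane.carrier) (epsSOf S 𝔠.lane.carrier) X.av j h U)
  (hWm : ∀ (j : ℕ) (h : Hist S.P j), Measurable (W'.mass j h)) (hmt : ∀ (j : ℕ) (U : GaugeField S.P j G), 1 ≤ W'.mass j (Hist.triv S.P j) U)

include hfam hB' hdom in
/-- ★★ **ROW B25 POINTWISE AT THE RE-MASSED TOWER UNDER THE HISTORY-DEPENDENT CAP** `W′_k(h,U) ≤ exp(c_m|T₁^{(k)}| + d(𝔤)c₁·Σ_{j<k}|Z_j(h)|)`, from the EDITION's rows `hLF67`∕`h68` (`RunAlphaEq324CoreLTAtAC … c`, any letter, range-honest bundle)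
(they read `X.UkH` = the re-massed input's composite minimisers): file 23 §1 at the re-massed input, the Z-rate read with the record's budget (`zcoefOf_add_le`), every other
lane-side hypothesis discharged as in III-a §1 — provisos of record unchanged. [cite: Balaban1985UV3, pp.273–274 + (67)–(68) p.273 + (39)–(41) p.266 + (7) p.257] -/
theorem lf_reMassedZ_of_coreLTAtAC {cm : ℝ} (hcm : 0 ≤ cm)
    (hcap : ∀ k, 1 ≤ k → k ≤ S.K → ∀ (h : Hist S.P k) (U : GaugeField S.P k G),
      W'.mass k h U ≤ Real.exp (cm * S.sites k + 𝔠.lane.carrier.dg * 𝔠.lane.carrier.c₁ *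
        ∑ j ∈ Finset.range k, (ZVol 𝔠.lane.carrier.M₁ (rcolOf S 𝔠.lane.carrier) k h j : ℝ)))
    (R : RunAlphaEq324CoreLTAtAC 𝔊 𝔠 X 𝔖 𝔄 c) :
    ∀ k, k ≤ (B'.withSeriesAC 𝔖 (piecesParamsOf S 𝔠.lane.carrier)).tower3.toTowerRun.K →
      ∀ U : (B'.withSeriesAC 𝔖 (piecesParamsOf S 𝔠.lane.carrier)).tower3.toTowerRun.Cfg k,
      (B'.withSeriesAC 𝔖 (piecesParamsOf S 𝔠.lane.carrier)).tower3.toTowerRun.LF k U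
          (fun h => -((B'.withSeriesAC 𝔖 (piecesParamsOf S 𝔠.lane.carrier)).tower3.toTowerRun.mainT k h U)
            + (B'.withSeriesAC 𝔖 (piecesParamsOf S 𝔠.lane.carrier)).tower3.toTowerRun.Zterm k h)
        ≤ Real.exp ((𝔠.lane.consts.d + cm) * (B'.withSeriesAC 𝔖 (piecesParamsOf S 𝔠.lane.carrier)).tower3.toTowerRun.sites k) := by
  subst hB'
  have hr₀ : 0 ≤ 𝔠.lane.carrier.r₀ := le_trans zero_le_one 𝔠.one_le_r₀
  have hCz : 0 ≤ 𝔠.lane.carrier.Cz + 𝔠.lane.carrier.Cv := add_nonneg 𝔠.Cz_nonneg 𝔠.Cv_nonneg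
  have hc₁ : 0 ≤ 𝔠.lane.carrier.c₁ := by show (0 : ℝ) ≤ 3; norm_num
  have hA : 0 ≤ (𝔠.lane.carrier.Cz + 𝔠.lane.carrier.Cv) + 𝔠.lane.carrier.C₅ + 𝔠.lane.carrier.C₆ +
      (|𝔠.lane.carrier.logσ₀| + 𝔠.lane.carrier.dg) * 𝔠.lane.carrier.c₁ := by
    have := 𝔠.lane.carrier.dg_nonneg
    have := abs_nonneg 𝔠.lane.carrier.logσ₀
    have h5 : 0 ≤ 𝔠.lane.carrier.C₅ := 𝔠.C₅_nonneg
    have h6 : 0 ≤ 𝔠.lane.carrier.C₆ := 𝔠.C₆_nonneg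
    positivity
  have hρ : (0 : ℝ) ≤ (𝔠.lane.carrier.R₁ + 1) * 𝔠.lane.carrier.M₁ := by
    have : 0 ≤ 𝔠.lane.carrier.R₁ := 𝔠.R₁_nonneg
    positivity
  exact lf_towerAC3_of_massBoundZ_const 𝔊 𝔠.lane.consts (consts3_d_eq_log 𝔠.lane.F 𝔠.lane.sc) rfl S.hL.2
    (({ X.toTowerBase 𝔠.lane.carrier with W := W' } : TowerBaseAC S G).withSeriesAC 𝔖 (piecesParamsOf S 𝔠.lane.carrier)) (gs := 1) (ε := S.g0sq)
    (fun k hk => by exact_mod_cast sites_eq_card S k (by omega))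
    (fun k h U hh => reMassed_mass_eq_zero_of_not_admissible W' hdom k h U hh)
    hcm (budget_nonneg 𝔠.lane.carrier hc₁) hcap (g0sq_pos S) 𝔠.C68_pos 𝔠.lane.F.b₀_pos 𝔠.lane.F.p₀_pos
    (fun j => by rw [show 𝔠.lane.consts.g = 1 from rfl, show 𝔠.lane.consts.L = (L : ℝ) from rfl]; exact gk_eq_gRun_norm S j)
    (fun j hj => (thresholds_of_le hfam j hj.le).2.2.2.1) R.hLF67 R.h68 𝔠.lane.F.M₁_pos
    (LargeFieldStd.rcolOf_antitone 𝔠.lane.carrier 𝔠.R₁_nonneg hr₀) hρ hr₀ (LargeFieldStd.rcolOf_le 𝔠.lane.carrier 𝔠.R₁_nonneg hr₀)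
    (LargeFieldStd.zcoefOf_nonneg 𝔠.lane.carrier hCz 𝔠.C₅_nonneg 𝔠.C₆_nonneg hc₁)
    (zcoefOf_add_le S 𝔠.lane.carrier hCz 𝔠.C₅_nonneg 𝔠.C₆_nonneg hc₁) hA
    (fun j hj => ⟨gk_pos S j, gk_le_one S S.gK_le_one j hj⟩) le_rfl 𝔠.prov_r₀p₀ (prov_hb₁ 𝔠 𝔊.N_pos) (prov_hb₂ 𝔠 𝔊.N_pos)

/-! ## §2 The whole analytic bundle at the re-massed tower under the history-dependent cap -/

include hfam hB' hae hdom hWm hmt in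
open Classical in
/-- ★★ **`UVStability3D.AnalyticLeaves C′ S T′` AT THE RE-MASSED TOWER `T′`, `C′ = {𝔠.lane.consts with d := d + c_m}`, FROM THE EDITED (α)-AC ROWS AND THE FIVE `W′`-HYPOTHESES WITH THE
HISTORY-DEPENDENT CAP** — part 2's bundle verbatim (step leaves from `…RowACReMassedSlot`, (1)₀, no interaction at level 0, B15, B20, B21) but for B25 = §1. [cite: Balaban1985UV3, pp.256–274 (the leaves) + (46) p.267 + (65) p.273 + pp.273–274] -/
theorem nonempty_analyticLeaves_reMassedZ_of_coreLTAtAC {cm : ℝ} (hcm : 0 ≤ cm)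
    (hcap : ∀ k, 1 ≤ k → k ≤ S.K → ∀ (h : Hist S.P k) (U : GaugeField S.P k G),
      W'.mass k h U ≤ Real.exp (cm * S.sites k + 𝔠.lane.carrier.dg * 𝔠.lane.carrier.c₁ *
        ∑ j ∈ Finset.range k, (ZVol 𝔠.lane.carrier.M₁ (rcolOf S 𝔠.lane.carrier) k h j : ℝ)))
    (R : RunAlphaEq324CoreLTAtAC 𝔊 𝔠 X 𝔖 𝔄 c) :
    Nonempty (UVStability3D.AnalyticLeaves { 𝔠.lane.consts with d := 𝔠.lane.consts.d + cm, d_nonneg := add_nonneg 𝔠.lane.consts.d_nonneg hcm } S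
      (B'.withSeriesAC 𝔖 (piecesParamsOf S 𝔠.lane.carrier)).tower3.toTowerRun) := by
  have hsteps := fun k (hk : k + 1 ≤ S.K) => exists_stepLeaves_reMassed_of_coreLTAtAC hfam W' B' hB' hae hdom hWm hmt hk (R.steps k hk)
  have hlf := lf_reMassedZ_of_coreLTAtAC hfam W' B' hB' hdom hcm hcap R
  have h46 := bound46_reMassed_of_coreLTAtAC hfam W' B' hB' R
  have hZT := fun k (hk : k + 1 ≤ S.K) => logZT_le_reMassed_of_coreLTAtAC W' B' hB' (R.steps k hk)
  have h0 := step0_reMassed W' B' hB' (𝔖 := 𝔖)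
  subst hB'
  refine ⟨{ step0 := h0
            noInt0 := TowerBaseAC.noInteraction0_seriesAC _ 𝔖 _
            steps := fun k hk => (hsteps k hk).choose
            bound46 := h46
            logZT_le := fun k hk => ?_
            PprT_le := fun k hk => ?_
            lf := hlf
            starT_eq := fun k hk => ?_
            logσ₀_le := fun k hk => ?_
            dg_le := fun k hk => ?_
            rem_eq := fun k hk => ?_ }⟩
  · rw [(hsteps k hk).choose_spec]; exact hZT k hk
  · have hk' : k + 1 ≤ S.K := hk
    rw [(hsteps k hk).choose_spec]
    exact LeavesCumAC.pprT_le_series_stdAC _ 𝔖 (piecesParamsOf S 𝔠.lane.carrier) k (by linarith [𝔠.kappa_ge]) 𝔠.C25_nonneg (by omega) (fun _ => 1)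
      (bound25_vac_coreLTAtAC (R.steps k hk')) (Inputs.nblk_cube_le_sites 𝔠.lane k (by omega))
  · rw [(hsteps k hk).choose_spec]; rfl
  · rw [(hsteps k hk).choose_spec]; exact le_rfl
  · rw [(hsteps k hk).choose_spec]; exact le_rfl
  · rw [(hsteps k hk).choose_spec]; rfl

end Lane

/-! ## §3 The printed pair at the record's binders along re-massed AC inputs with the history-dependent cap -/
section Slot

variable {N : ℕ} [NeZero N] {L : ℕ} {𝔊 : GroupModel (SU N)} {𝔠 : Primitives.AlphaConsts L 𝔊.N} {εbg cm : ℝ}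
  {X : ∀ S : Scales L, ExternalInputsAC S (SU N)}
  {𝔖 : ∀ (S : Scales L) (k : ℕ), StepSeries S (SU N) ↥(lieC 𝔊) (nblkOf S 𝔠.lane.carrier k) k}
  {𝔄 : ∀ S : Scales L, AlphaDataLTAC 𝔊 𝔠 (X S) (𝔖 S)}
  {c : ∀ (S : Scales L) (k : ℕ), Hist S.P (k + 1) → GaugeField S.P (k + 1) (SU N) → ℕ → ℝ}

/-- ★★ **`PrintedUV3G` AT THE RECORD'S BINDERS ALONG RE-MASSED AC INPUTS WITH THE HISTORY-DEPENDENT CAP, GIVEN THE WINDOW** (file 14 §3 on §2's bundles at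
`C′ = {𝔠.lane.consts with d := d + c_m}`): AC external inputs with the record's minimisers above level 0, `εbg > 0`, the window at every member of `Family L c⋆.eps0`, the EDITION
and the five `W′`-hypotheses at every member — dag-n08-w1's file 24 §3 one (α)-currency lower. [cite: Balaban1985UV3, Thm 1 p.257 + Thm 2 p.272 + pp.256–274] -/
theorem printedUV3G_at_record_of_coreLTAtAC_of_reMassedZ_of_window (W' : ∀ S : Scales L, HistWeightsAC S.P (SU N))
    (hUk : ∀ (S : Scales L) k (V : GaugeField S.P (k + 1) (SU N)), (X S).Uk k V = UkA N (fun S => (X S).av) S (k + 1) εbg V) (hpos : 0 < εbg)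
    (hwin : ∀ S : Family L (eps0Of 𝔠.gamma0), eps1OfPrint
        { eps0 := eps0Of 𝔠.gamma0,
          E := fun S => B10.Ek ((({ (X S).toTowerBase 𝔠.lane.carrier with W := W' S } : TowerBaseAC S (SU N)).withSeriesAC (𝔖 S)
            (Carriers.piecesParamsOf S 𝔠.lane.carrier)).Estep) S.K 0,
          b₀ := 𝔠.lane.F.b₀, p₀ := 𝔠.lane.F.p₀, εbg := εbg } S.1 0 ≤ εbg ∨ 2 < εbg)
    (R : ∀ S : Family L (eps0Of 𝔠.gamma0), RunAlphaEq324CoreLTAtAC 𝔊 𝔠 (X S.1) (𝔖 S.1) (𝔄 S.1) (c S.1)) (hcm : 0 ≤ cm)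
    (hae : ∀ S : Family L (eps0Of 𝔠.gamma0), ∀ j, j ≤ S.1.K → ∀ h : Hist S.1.P j, (W' S.1).mass j h =ᵐ[fieldMeasure S.1.P j (SU N)]
      massRecAC 𝔠.lane.carrier.M₁ (rcolOf S.1 𝔠.lane.carrier) (eps1Of S.1 𝔠.lane.carrier) (epsSOf S.1 𝔠.lane.carrier) (X S.1).av j h)
    (hdom : ∀ S : Family L (eps0Of 𝔠.gamma0), ∀ (j : ℕ) (h : Hist S.1.P j) (U : GaugeField S.1.P j (SU N)), (W' S.1).mass j h U ≤
      massRecAC 𝔠.lane.carrier.M₁ (rcolOf S.1 𝔠.lane.carrier) (eps1Of S.1 𝔠.lane.carrier) (epsSOf S.1 𝔠.lane.carrier) (X S.1).av j h U)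
    (hWm : ∀ S : Family L (eps0Of 𝔠.gamma0), ∀ (j : ℕ) (h : Hist S.1.P j), Measurable ((W' S.1).mass j h))
    (hmt : ∀ S : Family L (eps0Of 𝔠.gamma0), ∀ (j : ℕ) (U : GaugeField S.1.P j (SU N)), 1 ≤ (W' S.1).mass j (Hist.triv S.1.P j) U)
    (hcap : ∀ S : Family L (eps0Of 𝔠.gamma0), ∀ k, 1 ≤ k → k ≤ S.1.K → ∀ (h : Hist S.1.P k) (U : GaugeField S.1.P k (SU N)),
      (W' S.1).mass k h U ≤ Real.exp (cm * S.1.sites k + 𝔠.lane.carrier.dg * 𝔠.lane.carrier.c₁ *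
        ∑ j ∈ Finset.range k, (ZVol 𝔠.lane.carrier.M₁ (rcolOf S.1 𝔠.lane.carrier) k h j : ℝ))) :
    PrintedUV3G N L (runObjects₀A N (fun S => (X S).av)
      (fun S j => (Carriers.run3 ((({ (X S).toTowerBase 𝔠.lane.carrier with W := W' S } : TowerBaseAC S (SU N)).withSeriesAC (𝔖 S)
        (Carriers.piecesParamsOf S 𝔠.lane.carrier)).toRunInput fun _ => True)).T j)
      (Backgrounds.ofAvg N L fun S => (X S).av)) := by
  refine printedUV3G_of_analyticLeaves_towerAC3_of_window
    (fun S => (({ (X S).toTowerBase 𝔠.lane.carrier with W := W' S } : TowerBaseAC S (SU N)).withSeriesAC (𝔖 S) (Carriers.piecesParamsOf S 𝔠.lane.carrier)))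
    { eps0 := eps0Of 𝔠.gamma0,
      E := fun S => B10.Ek ((({ (X S).toTowerBase 𝔠.lane.carrier with W := W' S } : TowerBaseAC S (SU N)).withSeriesAC (𝔖 S)
        (Carriers.piecesParamsOf S 𝔠.lane.carrier)).Estep) S.K 0,
      b₀ := 𝔠.lane.F.b₀, p₀ := 𝔠.lane.F.p₀, εbg := εbg }
    (consts_adm_of_pos 𝔠 hpos _) (fun _ _ => rfl) (fun S k V => hUk S k V) (fun _ => rfl) hwin
    (C := { 𝔠.lane.consts with d := 𝔠.lane.consts.d + cm, d_nonneg := add_nonneg 𝔠.lane.consts.d_nonneg hcm }) 𝔠.lane.normalised (fun S => ?_)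
    (fun S => nonempty_analyticLeaves_reMassedZ_of_coreLTAtAC (le_of_eps0Of S.1 S.2) (W' S.1) _ rfl (hae S) (hdom S) (hWm S) (hmt S) hcm (hcap S) (R S))
  have u := usesConsts_reMassed (𝔠 := 𝔠) (X := X S.1) (𝔖 := 𝔖 S.1) (W' S.1) _ rfl (fun _ => True)
  exact ⟨u.M₁_eq, u.b₀_eq, u.p₀_eq, u.κ₀_eq, u.rcoef_eq, u.Λvol_nonneg⟩

/-! ## §4 The slot of record from the history-extensive a.e. mass bound: the re-massing chosen inside the proof -/

/-- ★★★ **THE SLOT OF RECORD `Node00.PrintedUV3V N L` FROM THE EDITED (α)-AC ROWS (the (3.24) row as print's SANDWICH at ANY letter, range-honest bundle) AND A `dU`-a.e. HISTORY-EXTENSIVE MASS BOUND, `b₀p₀^{p₀}e^{1−p₀} ≤ εbg`** — AC inputs AT PRINT'S OWN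
AVERAGING (`(X S).av = avOfPrint N S`) pinned to the record; the bound «`massRecAC … (X S).av k h U ≤ exp(c_m|T₁^{(k)}| + d(𝔤)c₁·Σ_{j<k}|Z_j(h)|)` for `dU_k`-a.e. `U`, `1 ≤ k ≤ K`» on the
family; the RE-MASSING `W′ = min (massRecAC) (e^{c_k + d(𝔤)c₁|Z_{<k}(h)|})` is chosen HERE and satisfies §2's five hypotheses by elementary facts.  NO E6′, no pointwise statement about a
Radon–Nikodym version, and — new — no history-uniformity of the bound: the printed Z-terms pay for the past. [cite: Balaban1985UV3, Thm 1 p.257 + Thm 2 p.272 + (41) p.266 + (7) p.257; Balaban1985Averaging, (15) p.19] -/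
theorem printedUV3V_at_slotOfRecord_of_coreLTAtAC_of_massBoundZAE_of_consts (hav : ∀ S, (X S).av = avOfPrint N S)
    (hUk : ∀ (S : Scales L) k (V : GaugeField S.P (k + 1) (SU N)), (X S).Uk k V = UkA N (fun S => (X S).av) S (k + 1) εbg V)
    (hε : 𝔠.lane.F.b₀ * (𝔠.lane.F.p₀ ^ 𝔠.lane.F.p₀ * Real.exp (1 - 𝔠.lane.F.p₀)) ≤ εbg)
    (R : ∀ S : Family L (eps0Of 𝔠.gamma0), RunAlphaEq324CoreLTAtAC 𝔊 𝔠 (X S.1) (𝔖 S.1) (𝔄 S.1) (c S.1)) (hcm : 0 ≤ cm)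
    (hmass : ∀ S : Family L (eps0Of 𝔠.gamma0), ∀ k, 1 ≤ k → k ≤ S.1.K → ∀ h : Hist S.1.P k, ∀ᵐ U ∂(fieldMeasure S.1.P k (SU N)),
      massRecAC 𝔠.lane.carrier.M₁ (rcolOf S.1 𝔠.lane.carrier) (eps1Of S.1 𝔠.lane.carrier) (epsSOf S.1 𝔠.lane.carrier) (X S.1).av k h U ≤
        Real.exp (cm * S.1.sites k + 𝔠.lane.carrier.dg * 𝔠.lane.carrier.c₁ *
          ∑ j ∈ Finset.range k, (ZVol 𝔠.lane.carrier.M₁ (rcolOf S.1 𝔠.lane.carrier) k h j : ℝ))) :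
    Node00.PrintedUV3V N L := by
  classical
  have hc₁ : 0 ≤ 𝔠.lane.carrier.c₁ := by show (0 : ℝ) ≤ 3; norm_num
  have hβ : 0 ≤ 𝔠.lane.carrier.dg * 𝔠.lane.carrier.c₁ := budget_nonneg 𝔠.lane.carrier hc₁
  -- the scale profile `c_0 = 0`, `c_k = c_m|T₁^{(k)}|`, and the history's budget `d(𝔤)c₁·Σ_{j<k}|Z_j(h)|`
  let cs : ∀ S : Scales L, ℕ → ℝ := fun S k => if k = 0 then 0 else cm * S.sites k
  have hc0 : ∀ S k, 0 ≤ cs S k := fun S k => by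
    by_cases hk : k = 0
    · simp only [cs, if_pos hk]; exact le_rfl
    · simp only [cs, if_neg hk]; exact mul_nonneg hcm (sites_nonneg S k)
  let b : ∀ S : Scales L, (k : ℕ) → Hist S.P k → ℝ := fun S k h =>
    𝔠.lane.carrier.dg * 𝔠.lane.carrier.c₁ * ∑ j ∈ Finset.range k, (ZVol 𝔠.lane.carrier.M₁ (rcolOf S 𝔠.lane.carrier) k h j : ℝ)
  have hb0 : ∀ S k h, 0 ≤ b S k h := fun S k h =>
    mul_nonneg hβ (Finset.sum_nonneg fun j _ => Nat.cast_nonneg _)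
  have hb_zero : ∀ S (h : Hist S.P 0), b S 0 h = 0 := fun S h => by simp only [b, Finset.range_zero, Finset.sum_empty, mul_zero]
  -- the re-massing `min (massRecAC) (e^{c_k + b_k(h)})`
  let W' : ∀ S : Scales L, HistWeightsAC S.P (SU N) := fun S =>
    { mass := fun k h U => min (massRecAC 𝔠.lane.carrier.M₁ (rcolOf S 𝔠.lane.carrier) (eps1Of S 𝔠.lane.carrier) (epsSOf S 𝔠.lane.carrier) (X S).av k h U)
        (Real.exp (cs S k + b S k h))
      mass_nonneg := fun k h U => le_min (massRecAC_nonneg _ _ _ _ _ k h U) (Real.exp_pos _).le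
      mass_zero := fun h U => by
        show min (massRecAC 𝔠.lane.carrier.M₁ (rcolOf S 𝔠.lane.carrier) (eps1Of S 𝔠.lane.carrier) (epsSOf S 𝔠.lane.carrier) (X S).av 0 h U)
          (Real.exp (cs S 0 + b S 0 h)) = 1
        rw [massRecAC_zero, hb_zero S h]
        simp only [cs, if_true, add_zero, Real.exp_zero, min_self] }
  -- the five hypotheses of §2
  have hae : ∀ S : Family L (eps0Of 𝔠.gamma0), ∀ j, j ≤ S.1.K → ∀ h : Hist S.1.P j, (W' S.1).mass j h =ᵐ[fieldMeasure S.1.P j (SU N)]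
      massRecAC 𝔠.lane.carrier.M₁ (rcolOf S.1 𝔠.lane.carrier) (eps1Of S.1 𝔠.lane.carrier) (epsSOf S.1 𝔠.lane.carrier) (X S.1).av j h := by
    intro S j hj h
    by_cases hj0 : j = 0
    · subst hj0
      refine Filter.Eventually.of_forall fun U => ?_
      show min _ _ = _
      rw [massRecAC_zero, hb_zero S.1 h]
      simp only [cs, if_true, add_zero, Real.exp_zero, min_self]
    · have h1 : 1 ≤ j := Nat.one_le_iff_ne_zero.mpr hj0
      filter_upwards [hmass S j h1 hj h] with U hU
      show min _ _ = _
      simp only [cs, if_neg hj0]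
      exact min_eq_left hU
  have hdom : ∀ S : Family L (eps0Of 𝔠.gamma0), ∀ (j : ℕ) (h : Hist S.1.P j) (U : GaugeField S.1.P j (SU N)), (W' S.1).mass j h U ≤
      massRecAC 𝔠.lane.carrier.M₁ (rcolOf S.1 𝔠.lane.carrier) (eps1Of S.1 𝔠.lane.carrier) (epsSOf S.1 𝔠.lane.carrier) (X S.1).av j h U :=
    fun S j h U => min_le_left _ _
  have hWm : ∀ S : Family L (eps0Of 𝔠.gamma0), ∀ (j : ℕ) (h : Hist S.1.P j), Measurable ((W' S.1).mass j h) :=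
    fun S j h => (measurable_massRecAC _ _ _ _ _ j h).min measurable_const
  have hmt : ∀ S : Family L (eps0Of 𝔠.gamma0), ∀ (j : ℕ) (U : GaugeField S.1.P j (SU N)), 1 ≤ (W' S.1).mass j (Hist.triv S.1.P j) U :=
    fun S j U => le_min (one_le_massRecAC_triv _ _ _ _ _ j U) (Real.one_le_exp (add_nonneg (hc0 S.1 j) (hb0 S.1 j _)))
  have hcap : ∀ S : Family L (eps0Of 𝔠.gamma0), ∀ k, 1 ≤ k → k ≤ S.1.K → ∀ (h : Hist S.1.P k) (U : GaugeField S.1.P k (SU N)),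
      (W' S.1).mass k h U ≤ Real.exp (cm * S.1.sites k + 𝔠.lane.carrier.dg * 𝔠.lane.carrier.c₁ *
        ∑ j ∈ Finset.range k, (ZVol 𝔠.lane.carrier.M₁ (rcolOf S.1 𝔠.lane.carrier) k h j : ℝ)) := by
    intro S k hk1 _ h U
    have hk0 : k ≠ 0 := by omega
    calc (W' S.1).mass k h U ≤ Real.exp (cs S.1 k + b S.1 k h) := min_le_right _ _
      _ = _ := by simp only [cs, b, if_neg hk0]
  -- the printed pair along the re-massed inputs, then the transfer to the slot of record's own binders
  obtain ⟨𝔗', h'⟩ := exists_TFamily₃_of_av_eq (N := N) (𝔞 := fun S => (X S).av) (funext hav)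
    (fun S j => (Carriers.run3 ((({ (X S).toTowerBase 𝔠.lane.carrier with W := W' S } : TowerBaseAC S (SU N)).withSeriesAC (𝔖 S)
      (Carriers.piecesParamsOf S 𝔠.lane.carrier)).toRunInput fun _ => True)).T j)
  have hR : runObjects₀A N (fun S => (X S).av)
      (fun S j => (Carriers.run3 ((({ (X S).toTowerBase 𝔠.lane.carrier with W := W' S } : TowerBaseAC S (SU N)).withSeriesAC (𝔖 S)
        (Carriers.piecesParamsOf S 𝔠.lane.carrier)).toRunInput fun _ => True)).T j)
      (Backgrounds.ofAvg N L fun S => (X S).av) = runObjects₀T N 𝔗' (Backgrounds.ofPrint N L) :=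
    funext fun c' => funext fun S => h' c' S
  exact ⟨𝔗', hR ▸ printedUV3G_at_record_of_coreLTAtAC_of_reMassedZ_of_window (𝔄 := 𝔄) (c := c) W' hUk (pos_of_famConsts hε)
    (fun S => window_of_famConsts hε _ S.1) R hcm hae hdom hWm hmt hcap⟩

variable (N L) in
/-- ★★★ **THE SLOT OF RECORD FROM ITS EDITED AC RESIDUALS WITH THE HISTORY-EXTENSIVE MASS BOUND STATED `dU`-a.e. ON PRINT'S OWN MASSES — A6 FORM** (file 9 §2's inhabitant: AC external
inputs AT PRINT'S AVERAGING with the record's classes and minimisers EXIST): for every `SU(N)`, `𝔠`, `εbg` with `b₀p₀^{p₀}e^{1−p₀} ≤ εbg`, `c_m ≥ 0`, THERE ARE such inputs `X`, and for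
every expansion data `𝔖` and (α)-AC data `𝔄` over them, **the EDITED (α)-AC rows on the family (any letter `c`, range-honest `𝔄`) ∧ «`massRecAC … (avOfPrint N S) k h ≤ exp(c_m|T₁^{(k)}| + d(𝔤)c₁·Σ_{j<k}|Z_j(h)|)` `dU_k`-a.e.,
`1 ≤ k ≤ K`» ⇒ `Node00.PrintedUV3V N L`** — dag-n08-w1's file 24 `…_of_consts'` one (α)-currency lower: the printed Z-terms of (41) pay for the history's past large-field fibre
volumes. [cite: Balaban1985UV3, Thm 1 p.257 + Thm 2 p.272 + (41) p.266; Balaban1985Averaging, (15) p.19] -/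
theorem printedUV3V_at_slotOfRecord_of_coreLTAtAC_of_massBoundZAE_of_consts' (𝔊 : GroupModel (SU N)) (𝔠 : Primitives.AlphaConsts L 𝔊.N) (εbg cm : ℝ)
    (hε : 𝔠.lane.F.b₀ * (𝔠.lane.F.p₀ ^ 𝔠.lane.F.p₀ * Real.exp (1 - 𝔠.lane.F.p₀)) ≤ εbg) (hcm : 0 ≤ cm) :
    ∃ X : ∀ S : Scales L, ExternalInputsAC S (SU N), (∀ S, (X S).av = avOfPrint N S) ∧
      ∀ (𝔖 : ∀ (S : Scales L) (k : ℕ), StepSeries S (SU N) ↥(lieC 𝔊) (nblkOf S 𝔠.lane.carrier k) k)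
        (𝔄 : ∀ S : Scales L, AlphaDataLTAC 𝔊 𝔠 (X S) (𝔖 S))
        (c : ∀ (S : Scales L) (k : ℕ), Hist S.P (k + 1) → GaugeField S.P (k + 1) (SU N) → ℕ → ℝ),
        (∀ S : Family L (eps0Of 𝔠.gamma0), RunAlphaEq324CoreLTAtAC 𝔊 𝔠 (X S.1) (𝔖 S.1) (𝔄 S.1) (c S.1)) →
        (∀ S : Family L (eps0Of 𝔠.gamma0), ∀ k, 1 ≤ k → k ≤ S.1.K → ∀ h : Hist S.1.P k, ∀ᵐ U ∂(fieldMeasure S.1.P k (SU N)),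
          massRecAC 𝔠.lane.carrier.M₁ (rcolOf S.1 𝔠.lane.carrier) (eps1Of S.1 𝔠.lane.carrier) (epsSOf S.1 𝔠.lane.carrier) (avOfPrint N S.1) k h U ≤
            Real.exp (cm * S.1.sites k + 𝔠.lane.carrier.dg * 𝔠.lane.carrier.c₁ *
              ∑ j ∈ Finset.range k, (ZVol 𝔠.lane.carrier.M₁ (rcolOf S.1 𝔠.lane.carrier) k h j : ℝ))) →
        Node00.PrintedUV3V N L := by
  obtain ⟨X, hav, -, hUk⟩ := exists_externalInputsAC_ofPrint N L εbg
  refine ⟨X, hav, fun 𝔖 𝔄 c R hmass => printedUV3V_at_slotOfRecord_of_coreLTAtAC_of_massBoundZAE_of_consts (𝔄 := 𝔄) (c := c) hav hUk hε R hcm fun S k hk1 hkK h => ?_⟩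
  have hX : (X S.1).av = avOfPrint N S.1 := hav S.1
  rw [hX]
  exact hmass S k hk1 hkK h

end Slot

end Summit.QuantumFields.YangMills.Theorems.BalabanUVNodesN08AlphaEq324RowACReMassedZSlot

end
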